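import Summits.KontsevichZagierPeriods.KontsevichZagierPeriods.Theorems.GrothendieckSectorComplementStubJointKernel

/-!
# Word classes of weights 2 and 4 are rational multiples of `ϖʷ` in the formal period ring
# (stub `stub_wordClass`, line `containment-join` (ring level), crux `Grothendieck.SectorComplement`,
# stmt-KontsevichZagierPeriods-11102)

For every admissible MZV word representation `x` of weight `w ∈ {2, 4}` (any rational scalar) and every
representation `p = [ℝ, 1/(1+x²)]` of `π`, there are `n ≠ 0` and `z ∈ ℤ` with `n • ⟦x⟧ = z • ⟦p⟧ʷ` in
`P = FormalRep ⧸ relations`. Ingredients, all landed: the rungs `weightKernelAdm_two`,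
`weightKernel_four` (Conjecture 1 in kernel form on the `ℤ`-span of the admissible weight-`w` words),
the value spans `eval (closure (genSetAdm w)) ⊆ ℚ·πʷ`, and the Euler cross relations
`6·[Δ₂, ω₀₁] ≡ [ℝ², ∏ 1/(1+xⱼ²)]`, `90·[Δ₄, ω₀₀₀₁] ≡ [ℝ⁴, ∏ 1/(1+xⱼ²)]` (`stub_eulerCross2/4`), whose
right-hand sides are the type-`(0,0,w)` lemniscatic monomial representations of class `⟦p⟧ʷ`
(`exists_monoRep`). This is the generator-by-generator input of the CONTAINMENT JOIN along the
`π`-root: each new generator costs ONE transfer and no transcendence.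

References: M. Kontsevich, D. Zagier, *Periods* (2001), §1.2, §4.1; L. Euler (1735).
-/

noncomputable section

open MeasureTheory Set
open Literature.NumberTheory.Transcendental
open Literature.NumberTheory.Transcendental.KZ
open Summit.KontsevichZagierPeriods.KontsevichZagierPeriods.Theses.Grothendieck
open Summit.KontsevichZagierPeriods.Grothendieck.GpcLegendreLemniscaticNegative
open Summit.KontsevichZagierPeriods.Grothendieck.LemniscaticSectorGlue
open Summit.KontsevichZagierPeriods.Grothendieck.SectorComplementAmalgamation
open Summit.KontsevichZagierPeriods.MzvKernelInKZ.Negative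

namespace Summit.KontsevichZagierPeriods.Grothendieck.SectorComplementRingJoin

/-- **One junction, generator by generator.** If kernel form holds on the `ℤ`-span of the admissible
weight-`w` words, every such combination has value in `ℚ·θ` for a backbone value `θ` (`πʷ`
along the π-root; `ζ(3)` at weight `3`), and ONE cross relation `N·[Δ_w, ω] ≡ m` with `eval m = θ`
is derivable, then every admissible weight-`w` generator `x` has a
non-zero multiple equal to an integer multiple of `⟦m⟧` in the formal period ring. [folklore] -/
theorem exists_nsmul_eq_zsmul_of_cross {w : ℕ} (hK : WeightKernelAdm w) {ω : Fin w → Bool}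
    (hω : Adm ω) {N : ℕ} (hN : N ≠ 0) {m : FormalRep} {θ : ℝ}
    (hcross : N • of (wordRep ω 1 hω) - m ∈ relations) (hm : eval m = θ)
    (hval : ∀ c ∈ AddSubgroup.closure (genSetAdm w), ∃ q : ℚ, eval c = q * θ)
    {x : FormalRep} (hx : x ∈ genSetAdm w) :
    ∃ (n : ℕ) (z : ℤ), n ≠ 0 ∧ n • toFormalPeriod x = z • toFormalPeriod m := by
  have hxc : x ∈ AddSubgroup.closure (genSetAdm w) := AddSubgroup.subset_closure hx
  have hωc : of (wordRep ω 1 hω) ∈ AddSubgroup.closure (genSetAdm w) :=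
    AddSubgroup.subset_closure (of_wordRep_mem_genSetAdm _ _ _)
  obtain ⟨q, hq⟩ := hval x hxc
  -- value of the unit word from the cross relation: `N · value [Δ_w, ω] = θ`
  have hωval : (N : ℝ) * eval (of (wordRep ω 1 hω)) = θ := by
    have h := relations_le_ker_eval_holds hcross
    rw [AddMonoidHom.mem_ker, map_sub, map_nsmul, nsmul_eq_mul, hm] at h
    linear_combination h
  -- the rational number `r = N q` and the kernel element `r.den • x − r.num • [Δ_w, ω]`
  set r : ℚ := N * q with hr
  have hrd : (r : ℝ) * r.den = r.num := by exact_mod_cast Rat.mul_den_eq_num r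
  have hker : r.den • x - r.num • of (wordRep ω 1 hω) ∈ relations := by
    refine hK _ (AddSubgroup.sub_mem _ (AddSubgroup.nsmul_mem _ hxc _)
      (AddSubgroup.zsmul_mem _ hωc _)) ?_
    rw [map_sub, map_nsmul, map_zsmul, nsmul_eq_mul, zsmul_eq_mul, hq]
    have hN' : (N : ℝ) ≠ 0 := by exact_mod_cast hN
    -- multiply the goal by `N` and use `N · eval [Δ_w, ω] = θ`, `r · den = num`, `r = N q`
    have key : (N : ℝ) * ((r.den : ℝ) * ((q : ℝ) * θ) -
        (r.num : ℝ) * eval (of (wordRep ω 1 hω))) = 0 := by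
      have hr' : (r : ℝ) = (N : ℝ) * (q : ℝ) := by rw [hr]; push_cast; ring
      rw [hr'] at hrd
      linear_combination θ * hrd - (r.num : ℝ) * hωval
    rcases mul_eq_zero.mp key with h | h
    · exact absurd h hN'
    · exact h
  refine ⟨N * r.den, r.num, Nat.mul_ne_zero hN r.den_nz, ?_⟩
  have h1 : (r.den : ℕ) • toFormalPeriod x = r.num • toFormalPeriod (of (wordRep ω 1 hω)) := by
    have h := toFormalPeriod_eq_zero_of_mem hker
    rw [map_sub, map_nsmul, map_zsmul, sub_eq_zero] at h
    exact h
  have h2 : N • toFormalPeriod (of (wordRep ω 1 hω)) = toFormalPeriod m := by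
    have h := toFormalPeriod_eq_zero_of_mem hcross
    rw [map_sub, map_nsmul, sub_eq_zero] at h
    exact h
  rw [mul_comm, mul_nsmul, h1, ← h2, smul_comm]

/-- **`stub_wordClass`** (registered stub of line `containment-join`, crux stmt-KontsevichZagierPeriods-11102):
every admissible word class of weight `2` or `4` is a rational multiple of `ϖʷ` in the formal period
ring, `ϖ = ⟦[ℝ, 1/(1+x²)]⟧`. [folklore] -/
theorem stub_wordClass :
    ∀ (w : ℕ), (w = 2 ∨ w = 4) →
    ∀ (p : IntegralRep 1), p.domain = Set.univ → (p.integrand = fun x => 1 / (1 + x 0 ^ 2)) →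
      ∀ x ∈ genSetAdm w, ∃ (n : ℕ) (z : ℤ), n ≠ 0 ∧
        n • toFormalPeriod x = z • toFormalPeriod (of p) ^ w := by
  rintro w hw p hpd hpi x hx
  rcases hw with rfl | rfl
  · -- weight 2: cross relation `6·[Δ₂, ω₀₁] ≡ [ℝ², ∏ 1/(1+xⱼ²)]`
    obtain ⟨m, hmd, hmi, hmP⟩ := exists_monoRep p hpd hpi 0 0 2
    have hmval : eval (of m) = Real.pi ^ 2 := value_monoRep_pi p hpd hpi m hmP
    have hcross : 6 • of (wordRep ω2 1 adm_ω2) - of m ∈ relations :=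
      stub_eulerCross2 m hmd (fun x _ => by rw [hmi])
    obtain ⟨n, z, hn, h⟩ := exists_nsmul_eq_zsmul_of_cross weightKernelAdm_two adm_ω2
      (by norm_num) hcross hmval (fun c hc => exists_rat_eval_of_mem_closure_two hc) hx
    refine ⟨n, z, hn, ?_⟩
    rw [h, hmP, pow_zero, pow_zero, one_mul, one_mul]
  · -- weight 4: cross relation `90·[Δ₄, ω₀₀₀₁] ≡ [ℝ⁴, ∏ 1/(1+xⱼ²)]`
    obtain ⟨m, hmd, hmi, hmP⟩ := exists_monoRep p hpd hpi 0 0 4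
    have hmval : eval (of m) = Real.pi ^ 4 := value_monoRep_pi p hpd hpi m hmP
    have hcross : 90 • of (wordRep ω4 1 adm_ω4) - of m ∈ relations :=
      stub_eulerCross4 m hmd (fun x _ => by rw [hmi])
    obtain ⟨n, z, hn, h⟩ := exists_nsmul_eq_zsmul_of_cross
      (weightKernelAdm_of_weightKernel weightKernel_four) adm_ω4
      (by norm_num) hcross hmval (fun c hc => exists_rat_eval_of_mem_closure_four hc) hx
    refine ⟨n, z, hn, ?_⟩
    rw [h, hmP, pow_zero, pow_zero, one_mul, one_mul]

end Summit.KontsevichZagierPeriods.Grothendieck.SectorComplementRingJoin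

end
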